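import Summits.NavierStokesRegularity.NavierStokesRegularity.Theorems.AdaptedFrequencyAdaptedKernelExistsLowerOfUpperBridge
import Literature.Analysis.FluidPDE.WholeSpaceIBP

/-!
# Crux `AdaptedKernelExists` (stmt-NavierStokesRegularity-2956), line `nash-entropy-last-block`:
  STUB `stub_kernelLimit`, part 4a — slice calculus for space–time test functions

Helper file (lands `--supports stmt-NavierStokesRegularity-2956`) on the proof path of the
registered stub `stub_kernelLimit`.  The very weak form of the backward drift–heat equation (the
currency of the gen-4 skeleton of the line) is written with SLICE derivatives of the test
function `φ : ℝ × E → ℝ`: `deriv (fun s => φ (s, x)) t`, `fderiv ℝ (fun y => φ (t, y)) x`,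
`Δ (fun y => φ (t, y)) x`.  This file records their elementary calculus for a smooth compactly
supported `φ`: identification with the joint derivative (`kernelLimit_deriv_slice_eq`,
`kernelLimit_fderiv_slice_eq`), joint continuity (`kernelLimit_continuous_deriv_slice`,
`…_fderiv_slice`, `…_laplacian_slice`), vanishing off the support
(`kernelLimit_sliceDerivs_eq_zero`), compact support of slices
(`kernelLimit_hasCompactSupport_slice`), and a continuity criterion for functions continuous on
an open set containing their support (`kernelLimit_continuous_of_tsupport_subset`).
-/

noncomputable section

open MeasureTheory Set Filter Topology Metric Function
open scoped Laplacian ContDiff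
open Literature.Analysis.FluidPDE

namespace Summit.NavierStokesRegularity.NavierStokesRegularity.Theorems.AdaptedKernelExists.NashEntropyLastBlock

/-! ### A continuity criterion -/

section Continuity

variable {X Y : Type*} [TopologicalSpace X] [TopologicalSpace Y] [Zero Y]

/-- A function which is continuous on an open set `V` containing its topological support is
continuous everywhere. -/
theorem kernelLimit_continuous_of_tsupport_subset {f : X → Y} {V : Set X} (hV : IsOpen V)
    (hf : ContinuousOn f V) (hfs : tsupport f ⊆ V) : Continuous f := by
  rw [continuous_iff_continuousAt]
  intro x
  by_cases hx : x ∈ V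
  · exact (hf x hx).continuousAt (hV.mem_nhds hx)
  · have hx' : x ∉ tsupport f := fun h' => hx (hfs h')
    have h0 : (fun _ => (0 : Y)) =ᶠ[𝓝 x] f := by
      filter_upwards [(isClosed_tsupport f).isOpen_compl.mem_nhds hx'] with y hy
      exact (image_eq_zero_of_notMem_tsupport hy).symm
    exact continuousAt_const.congr h0

end Continuity

section General

variable {E : Type*} [NormedAddCommGroup E] [InnerProductSpace ℝ E] [FiniteDimensional ℝ E]
  [MeasurableSpace E] [BorelSpace E]

/-! ### Slice calculus for a smooth compactly supported test function -/

omit [FiniteDimensional ℝ E] [MeasurableSpace E] [BorelSpace E] in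
/-- The time-slice derivative of a `C¹` function of `(t, x)` is the joint derivative on `(1, 0)`. -/
theorem kernelLimit_deriv_slice_eq {φ : ℝ × E → ℝ} (hφ : ContDiff ℝ 1 φ) (p : ℝ × E) :
    deriv (fun s => φ (s, p.2)) p.1 = fderiv ℝ φ p (1, 0) := by
  have hd : HasFDerivAt (uncurry fun s y => φ (s, y)) (fderiv ℝ φ p) (p.1, p.2) :=
    (hφ.differentiable one_ne_zero p).hasFDerivAt
  exact (hasDerivAt_timeLine hd).deriv

omit [FiniteDimensional ℝ E] [MeasurableSpace E] [BorelSpace E] in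
/-- The space-slice derivative of a `C¹` function of `(t, x)` is the joint derivative on `(0, ·)`. -/
theorem kernelLimit_fderiv_slice_eq {φ : ℝ × E → ℝ} (hφ : ContDiff ℝ 1 φ) (p : ℝ × E) (v : E) :
    fderiv ℝ (fun y => φ (p.1, y)) p.2 v = fderiv ℝ φ p (0, v) := by
  have hd : HasFDerivAt (uncurry fun s y => φ (s, y)) (fderiv ℝ φ p) (p.1, p.2) :=
    (hφ.differentiable one_ne_zero p).hasFDerivAt
  have := (hasFDerivAt_slice hd).fderiv
  rw [this]
  simp

omit [FiniteDimensional ℝ E] [MeasurableSpace E] [BorelSpace E] in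
/-- The time-slice derivative of a smooth `φ` is continuous in `(t, x)`. -/
theorem kernelLimit_continuous_deriv_slice {φ : ℝ × E → ℝ} (hφ : ContDiff ℝ ∞ φ) :
    Continuous fun p : ℝ × E => deriv (fun s => φ (s, p.2)) p.1 := by
  have h1 : ContDiff ℝ 1 φ := hφ.of_le (by norm_cast)
  have : (fun p : ℝ × E => deriv (fun s => φ (s, p.2)) p.1) = fun p => fderiv ℝ φ p (1, 0) :=
    funext fun p => kernelLimit_deriv_slice_eq h1 p
  rw [this]
  exact (h1.continuous_fderiv one_ne_zero).clm_apply continuous_const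

omit [FiniteDimensional ℝ E] [MeasurableSpace E] [BorelSpace E] in
/-- The space-slice gradient of a smooth `φ` is continuous in `(t, x)` (as a linear map). -/
theorem kernelLimit_continuous_fderiv_slice {φ : ℝ × E → ℝ} (hφ : ContDiff ℝ ∞ φ) :
    Continuous fun p : ℝ × E => fderiv ℝ (fun y => φ (p.1, y)) p.2 := by
  have h := lowerOfUpper_continuousOn_fderiv_slice (G := fun t y => φ (t, y)) isOpen_univ
    (hφ.contDiffOn.of_le (by norm_cast))
  rw [univ_prod_univ] at h
  exact continuousOn_univ.1 h

omit [MeasurableSpace E] [BorelSpace E] in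
/-- The space-slice Laplacian of a smooth `φ` is continuous in `(t, x)`. -/
theorem kernelLimit_continuous_laplacian_slice {φ : ℝ × E → ℝ} (hφ : ContDiff ℝ ∞ φ) :
    Continuous fun p : ℝ × E => (Δ (fun y => φ (p.1, y))) p.2 := by
  have h := lowerOfUpper_continuousOn_laplacian_slice (G := fun t y => φ (t, y)) isOpen_univ
    (hφ.contDiffOn.of_le (by norm_cast))
  rw [univ_prod_univ] at h
  exact continuousOn_univ.1 h

omit [InnerProductSpace ℝ E] [FiniteDimensional ℝ E] [MeasurableSpace E] [BorelSpace E] in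
/-- Off the topological support of `φ`, the point `p.2` is off the support of the slice
`φ (p.1, ·)`. -/
theorem kernelLimit_notMem_tsupport_slice {φ : ℝ × E → ℝ} {p : ℝ × E} (hp : p ∉ tsupport φ) :
    p.2 ∉ tsupport fun y => φ (p.1, y) := by
  intro h
  have hsub : tsupport (fun y => φ (p.1, y)) ⊆ (fun y => (p.1, y)) ⁻¹' tsupport φ := by
    refine closure_minimal ?_ ((isClosed_tsupport φ).preimage (by fun_prop))
    intro y hy
    exact subset_tsupport _ hy
  exact hp (by simpa using hsub h)

omit [InnerProductSpace ℝ E] [FiniteDimensional ℝ E] [MeasurableSpace E] [BorelSpace E] in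
/-- Off the topological support of `φ`, the time `p.1` is off the support of the time line
`φ (·, p.2)`. -/
theorem kernelLimit_notMem_tsupport_timeLine {φ : ℝ × E → ℝ} {p : ℝ × E} (hp : p ∉ tsupport φ) :
    p.1 ∉ tsupport fun s => φ (s, p.2) := by
  intro h
  have hsub : tsupport (fun s => φ (s, p.2)) ⊆ (fun s => (s, p.2)) ⁻¹' tsupport φ := by
    refine closure_minimal ?_ ((isClosed_tsupport φ).preimage (by fun_prop))
    intro s hs
    exact subset_tsupport _ hs
  exact hp (by simpa using hsub h)

omit [MeasurableSpace E] [BorelSpace E] in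
/-- Off the support of `φ` all slice derivatives entering the very weak form vanish. -/
theorem kernelLimit_sliceDerivs_eq_zero {φ : ℝ × E → ℝ} {p : ℝ × E} (hp : p ∉ tsupport φ)
    (v : E) :
    deriv (fun s => φ (s, p.2)) p.1 = 0 ∧ fderiv ℝ (fun y => φ (p.1, y)) p.2 v = 0 ∧
      (Δ (fun y => φ (p.1, y))) p.2 = 0 := by
  refine ⟨?_, ?_, laplacian_eq_zero_of_notMem_tsupport (kernelLimit_notMem_tsupport_slice hp)⟩
  · have h := kernelLimit_notMem_tsupport_timeLine hp
    rw [← fderiv_apply_one_eq_deriv, fderiv_of_notMem_tsupport ℝ h]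
    rfl
  · rw [fderiv_of_notMem_tsupport ℝ (kernelLimit_notMem_tsupport_slice hp)]
    rfl

omit [InnerProductSpace ℝ E] [FiniteDimensional ℝ E] [MeasurableSpace E] [BorelSpace E] in
/-- Time slices of a compactly supported function of `(t, x)` have compact support. -/
theorem kernelLimit_hasCompactSupport_slice {φ : ℝ × E → ℝ} (hφc : HasCompactSupport φ) (t : ℝ) :
    HasCompactSupport fun y => φ (t, y) := by
  refine HasCompactSupport.intro (hφc.isCompact.image continuous_snd) fun y hy => ?_
  by_contra h
  exact hy ⟨(t, y), subset_tsupport _ h, rfl⟩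

/-! ### Registered sub-goal (dimension three) -/

/-- **Registered sub-goal `stub_kernelLimit_sliceDerivsZero`** (the `ℝ³` form of
`kernelLimit_sliceDerivs_eq_zero`; part 4a of the proof of STUB `stub_kernelLimit`): off the
support of a space–time test function all slice derivatives entering the very weak form vanish. -/
theorem stub_kernelLimit_sliceDerivsZero :
    ∀ (φ : ℝ × EuclideanSpace ℝ (Fin 3) → ℝ) (p : ℝ × EuclideanSpace ℝ (Fin 3)) (v : EuclideanSpace ℝ (Fin 3)), p ∉ tsupport φ → deriv (fun s => φ (s, p.2)) p.1 = 0 ∧ fderiv ℝ (fun y => φ (p.1, y)) p.2 v = 0 ∧ (Δ (fun y => φ (p.1, y))) p.2 = 0 :=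
  fun _ _ v hp => kernelLimit_sliceDerivs_eq_zero hp v

end General

end Summit.NavierStokesRegularity.NavierStokesRegularity.Theorems.AdaptedKernelExists.NashEntropyLastBlock

end
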